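import Summits.AtomisticToContinuum.Crystallization.Theorems.ThreeConeCertificateSlackRigidityLayeringHex

/-!
# Line `c-layer-witness-strictness` (crux `SlackRigidity`, stmt-AtomisticToContinuum-11960):
# layering off the ideal ratio — part 2/4, the standard 13-point star

Stub `stub_layeringOffIdeal`, part 2: on the window `0.775 a < h < 0.894 a` the closed ball of
radius `6a/5` about the site `0` of a Barlow stacking `barlowStacking a h s` (`s` Hägg) contains
EXACTLY thirteen stacking points — the site, the hexagon `H = {±u, ±v, ±(u − v)}` of layer `0`,
the lifted hole triple `h e₃ + σ₊ {w, w − u, w − v}` of layer `1` (`σ₊ = s 0`) and the lowered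
hole triple `−h e₃ + σ₋ {w, w − u, w − v}` of layer `−1` (`σ₋ = −s (−1)`):
`layeringStar_stacking_inter_closedBall`.  (Layer `0` needs `i² + ij + j² ≤ 1.44`; layers `±1` need
the integer `i² + ij + j² ± (i + j)` to vanish since `h² > 0.6 a²`; `|k| ≥ 2` is excluded by
`2h > 1.55 a`.)  With it: the norm-`a` points of the star are the hexagon off the ideal ratio
(`b² = a²/3 + h² ≠ a²`), and the sign read-off lemmas for `± h e₃ + σ w`. All `[folklore]`.
-/

noncomputable section

namespace Summit.AtomisticToContinuum.Crystallization.Theorems.CLayerWitnessLayering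

open Literature.MathematicalPhysics.StatisticalMechanics RealInnerProductSpace

/-- Euclidean `3`-space. -/
local notation "E3" => EuclideanSpace ℝ (Fin 3)
set_option hygiene false in
/-- First in-layer generator `u = (a, 0, 0)` (the ambient `a`). -/
local notation "𝐮" => triangularVec₁ a
set_option hygiene false in
/-- Second in-layer generator `v = (a/2, a√3/2, 0)`. -/
local notation "𝐯" => triangularVec₂ a
set_option hygiene false in
/-- The hole offset `w = (u + v)/3`. -/
local notation "𝐰" => barlowOffset a
set_option hygiene false in
/-- The interlayer vector `h e₃` (the ambient `h`). -/
local notation "𝐞" => layerNormal h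
set_option hygiene false in
/-- The standard hexagon `H = {u, v, −u, −v, u − v, v − u}`. -/
local notation "Hex" => ({triangularVec₁ a, triangularVec₂ a, -triangularVec₁ a, -triangularVec₂ a,
    triangularVec₁ a - triangularVec₂ a, triangularVec₂ a - triangularVec₁ a} :
      Set (EuclideanSpace ℝ (Fin 3)))
variable {a h : ℝ}

set_option hygiene false in
/-- The hole points `{w, w − u, w − v}` of class `+1`. -/
local notation "Holes" => ({barlowOffset a, barlowOffset a - triangularVec₁ a,
    barlowOffset a - triangularVec₂ a} : Set (EuclideanSpace ℝ (Fin 3)))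
set_option hygiene false in
/-- The lifted signed hole triple `h e₃ + τ {w, w − u, w − v}`. -/
local notation "Up[" τ "]" => ({layerNormal h + τ • barlowOffset a,
    layerNormal h + τ • (barlowOffset a - triangularVec₁ a),
    layerNormal h + τ • (barlowOffset a - triangularVec₂ a)} : Set (EuclideanSpace ℝ (Fin 3)))
set_option hygiene false in
/-- The lowered signed hole triple `−h e₃ + τ {w, w − u, w − v}`. -/
local notation "Dn[" τ "]" => ({-layerNormal h + τ • barlowOffset a,
    -layerNormal h + τ • (barlowOffset a - triangularVec₁ a),
    -layerNormal h + τ • (barlowOffset a - triangularVec₂ a)} : Set (EuclideanSpace ℝ (Fin 3)))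
set_option hygiene false in
/-- The standard 13-point star with upper class `τ₁` and lower class `τ₂`. -/
local notation "Std[" σ ", " τ "]" =>
  (({0} : Set (EuclideanSpace ℝ (Fin 3))) ∪ Hex ∪ Up[σ] ∪ Dn[τ])

/-! ## Integer enumerations -/

/-- Layer `0` of the star: the integer points with `i² + ij + j² ≤ 1.44` are the origin and the
hexagon. [folklore] -/
theorem layer_zero_cases {i j : ℤ} (hq : ((i : ℝ) ^ 2 + i * j + j ^ 2) ≤ 1.44) :
    (i = 0 ∧ j = 0) ∨ (i = 1 ∧ j = 0) ∨ (i = 0 ∧ j = 1) ∨ (i = -1 ∧ j = 0) ∨ (i = 0 ∧ j = -1) ∨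
    (i = 1 ∧ j = -1) ∨ (i = -1 ∧ j = 1) := by
  have h2 : ((i ^ 2 + i * j + j ^ 2 : ℤ) : ℝ) < 2 := by push_cast; linarith
  have h2' : i ^ 2 + i * j + j ^ 2 < 2 := by exact_mod_cast h2
  have hi : -1 ≤ i ∧ i ≤ 1 := by
    constructor <;> nlinarith [sq_nonneg (2 * j + i), sq_nonneg (2 * i + j)]
  have hj : -1 ≤ j ∧ j ≤ 1 := by
    constructor <;> nlinarith [sq_nonneg (2 * j + i), sq_nonneg (2 * i + j)]
  obtain ⟨hi1, hi2⟩ := hi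
  obtain ⟨hj1, hj2⟩ := hj
  interval_cases i <;> interval_cases j <;> first | decide | (exfalso; norm_num at h2')

/-- Layers `±1` of the star: the integer points with `i² + ij + j² + L(i + j) + 1/3 < 0.84`
(`L = ±1` the letter of the layer) are the three corners of the hole. [folklore] -/
theorem layer_one_cases {L i j : ℤ} (hL : L = 1 ∨ L = -1)
    (hq : ((i : ℝ) ^ 2 + i * j + j ^ 2 + L * (i + j) + 1 / 3) < 0.84) :
    (L = 1 ∧ ((i = 0 ∧ j = 0) ∨ (i = -1 ∧ j = 0) ∨ (i = 0 ∧ j = -1))) ∨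
    (L = -1 ∧ ((i = 0 ∧ j = 0) ∨ (i = 1 ∧ j = 0) ∨ (i = 0 ∧ j = 1))) := by
  have h2 : ((i ^ 2 + i * j + j ^ 2 + L * (i + j) : ℤ) : ℝ) < 1 := by push_cast; linarith
  have h2' : i ^ 2 + i * j + j ^ 2 + L * (i + j) < 1 := by exact_mod_cast h2
  rcases hL with rfl | rfl
  · left
    refine ⟨rfl, ?_⟩
    have hi : -1 ≤ i ∧ i ≤ 0 := by
      constructor <;> nlinarith [sq_nonneg (2 * j + i + 1), sq_nonneg (2 * i + j + 1)]
    have hj : -1 ≤ j ∧ j ≤ 0 := by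
      constructor <;> nlinarith [sq_nonneg (2 * j + i + 1), sq_nonneg (2 * i + j + 1)]
    obtain ⟨hi1, hi2⟩ := hi
    obtain ⟨hj1, hj2⟩ := hj
    interval_cases i <;> interval_cases j <;> first | decide | (exfalso; norm_num at h2')
  · right
    refine ⟨rfl, ?_⟩
    have hi : 0 ≤ i ∧ i ≤ 1 := by
      constructor <;> nlinarith [sq_nonneg (2 * j + i - 1), sq_nonneg (2 * i + j - 1)]
    have hj : 0 ≤ j ∧ j ≤ 1 := by
      constructor <;> nlinarith [sq_nonneg (2 * j + i - 1), sq_nonneg (2 * i + j - 1)]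
    obtain ⟨hi1, hi2⟩ := hi
    obtain ⟨hj1, hj2⟩ := hj
    interval_cases i <;> interval_cases j <;> first | decide | (exfalso; norm_num at h2')

/-- Only the layers `k = 0, ±1` meet the star: `c + k² h² ≤ 1.44 a²` with `c ≥ 0`, `h > 0.775 a`
forces `|k| ≤ 1`. [folklore] -/
theorem layer_index_cases (ha : 0 < a) (hw1 : 0.775 * a < h) {k : ℤ} {c : ℝ} (hc : 0 ≤ c)
    (hk : c + ((k : ℝ) * h) ^ 2 ≤ (6 * a / 5) ^ 2) : k = 0 ∨ k = 1 ∨ k = -1 := by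
  have h1 : ((k : ℝ)) ^ 2 < 4 := by
    by_contra hcon
    rw [not_lt] at hcon
    have : (4 : ℝ) * h ^ 2 ≤ (k : ℝ) ^ 2 * h ^ 2 := by nlinarith
    have hh : 0 < h := by linarith
    nlinarith
  have h2 : ((k ^ 2 : ℤ) : ℝ) < 4 := by push_cast; exact h1
  have h3 : k ^ 2 < 4 := by exact_mod_cast h2
  have h4 : -1 ≤ k ∧ k ≤ 1 := by constructor <;> nlinarith
  omega

/-! ## Coordinates of the stacking points -/

/-- The site `(0, 0, 0)` of the stacking is the origin. [folklore] -/
theorem barlowPos_zero_zero_zero (s : ℤ → ℤ) : barlowPos a h s 0 0 0 = 0 := by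
  simp [barlowPos]

/-- `haggLabel s 1 = s 0`. [folklore] -/
theorem haggLabel_one (s : ℤ → ℤ) : haggLabel s 1 = s 0 := by
  have := haggLabel_succ s 0
  rwa [zero_add, haggLabel_zero, zero_add] at this

/-- `haggLabel s (−1) = −s (−1)`. [folklore] -/
theorem haggLabel_neg_one (s : ℤ → ℤ) : haggLabel s (-1) = -s (-1) := by
  have := haggLabel_succ s (-1)
  rw [neg_add_cancel, haggLabel_zero] at this
  linarith

/-- **Squared norm of a stacking point**: lateral part `a² (i² + ij + j² + L(i+j) + L²/3)`
(`L` the label of the layer) plus vertical part `k² h²`. [folklore] -/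
theorem norm_barlowPos_sq (s : ℤ → ℤ) (k i j : ℤ) :
    ‖barlowPos a h s k i j‖ ^ 2 =
      a ^ 2 * ((i : ℝ) ^ 2 + i * j + j ^ 2 + haggLabel s k * (i + j) +
        (haggLabel s k : ℝ) ^ 2 / 3) + ((k : ℝ) * h) ^ 2 := by
  have hd := dist_barlowPos_sq a h s k i j 0 0 0
  rw [barlowPos_zero_zero_zero, dist_zero_right, haggLabel_zero] at hd
  rw [hd]
  push_cast
  linear_combination (a ^ 2 / 4 * ((j : ℝ) + haggLabel s k / 3) ^ 2) * sqrt_three_sq'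

/-- A stacking point, written in the frame. [folklore] -/
theorem barlowPos_eq_frame (s : ℤ → ℤ) (k i j : ℤ) :
    barlowPos a h s k i j = (i : ℝ) • 𝐮 + (j : ℝ) • 𝐯 + (haggLabel s k : ℝ) • 𝐰 + (k : ℝ) • 𝐞 :=
  rfl

/-! ## The standard star -/

/-- Unpacking membership in a lifted hole triple. [folklore] -/
theorem exists_of_mem_up {τ : ℝ} {x : E3} (hx : x ∈ Up[τ]) : ∃ t ∈ Holes, x = 𝐞 + τ • t := by
  simp only [Set.mem_insert_iff, Set.mem_singleton_iff] at hx
  rcases hx with rfl | rfl | rfl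
  · exact ⟨_, by simp, rfl⟩
  · exact ⟨_, by simp, rfl⟩
  · exact ⟨_, by simp, rfl⟩

/-- Unpacking membership in a lowered hole triple. [folklore] -/
theorem exists_of_mem_dn {τ : ℝ} {x : E3} (hx : x ∈ Dn[τ]) : ∃ t ∈ Holes, x = -𝐞 + τ • t := by
  simp only [Set.mem_insert_iff, Set.mem_singleton_iff] at hx
  rcases hx with rfl | rfl | rfl
  · exact ⟨_, by simp, rfl⟩
  · exact ⟨_, by simp, rfl⟩
  · exact ⟨_, by simp, rfl⟩

/-- The radius bound: `a²/3 + h² ≤ (6a/5)²` on the window. [folklore] -/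
theorem third_add_sq_le (ha : 0 < a) (hh : 0 < h) (hw2 : h < 0.894 * a) :
    a ^ 2 / 3 + h ^ 2 ≤ (6 * a / 5) ^ 2 := by nlinarith

/-- **The standard 13-point star** of a Barlow stacking on the window `0.775 a < h < 0.894 a`:
`barlowStacking a h s ∩ B̄(0, 6a/5) = {0} ∪ H ∪ (h e₃ + (s 0) T) ∪ (−h e₃ + (−s(−1)) T)`,
`T = {w, w − u, w − v}`. [folklore] -/
theorem layeringStar_stacking_inter_closedBall (ha : 0 < a) (hh : 0 < h) (hw1 : 0.775 * a < h)
    (hw2 : h < 0.894 * a) {s : ℤ → ℤ} (hs : IsHaggSeq s) :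
    barlowStacking a h s ∩ Metric.closedBall 0 (6 * a / 5) =
      Std[((s 0 : ℤ) : ℝ), -((s (-1) : ℤ) : ℝ)] := by
  have hL1 : haggLabel s 1 = s 0 := haggLabel_one s
  have hLm : haggLabel s (-1) = -s (-1) := haggLabel_neg_one s
  have hb := third_add_sq_le ha hh hw2
  have hball : ∀ x : E3, ⟪x, x⟫ ≤ (6 * a / 5) ^ 2 → x ∈ Metric.closedBall (0 : E3) (6 * a / 5) := by
    intro x hx
    rw [Metric.mem_closedBall, dist_zero_right]
    rw [real_inner_self_eq_norm_sq] at hx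
    exact (pow_le_pow_iff_left₀ (norm_nonneg _) (by positivity) two_ne_zero).1 hx
  have ha2 : 0 < a ^ 2 := by positivity
  ext x
  constructor
  · rintro ⟨⟨k, i, j, rfl⟩, hx⟩
    rw [Metric.mem_closedBall, dist_zero_right] at hx
    have hsq : ‖barlowPos a h s k i j‖ ^ 2 ≤ (6 * a / 5) ^ 2 :=
      pow_le_pow_left₀ (norm_nonneg _) hx 2
    rw [norm_barlowPos_sq] at hsq
    have hlat : 0 ≤ a ^ 2 * ((i : ℝ) ^ 2 + i * j + j ^ 2 + haggLabel s k * (i + j) +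
        (haggLabel s k : ℝ) ^ 2 / 3) := by
      nlinarith [sq_nonneg (a * (i + j / 2 + haggLabel s k / 2)),
        sq_nonneg (a * ((j : ℝ) + haggLabel s k / 3)), sq_nonneg a]
    simp only [Set.mem_union, Set.mem_singleton_iff]
    rcases layer_index_cases ha hw1 hlat hsq with rfl | rfl | rfl
    · -- layer 0
      rw [haggLabel_zero] at hsq
      push_cast at hsq
      have hq : ((i : ℝ) ^ 2 + i * j + j ^ 2) ≤ 1.44 := by nlinarith [ha2]
      left; left
      rw [barlowPos_eq_frame, haggLabel_zero]
      push_cast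
      rcases layer_zero_cases hq with ⟨rfl, rfl⟩ | ⟨rfl, rfl⟩ | ⟨rfl, rfl⟩ | ⟨rfl, rfl⟩ |
        ⟨rfl, rfl⟩ | ⟨rfl, rfl⟩ | ⟨rfl, rfl⟩
      · left; push_cast; module
      all_goals
        right
        simp only [Set.mem_insert_iff, Set.mem_singleton_iff]
        push_cast
        first
        | exact Or.inl (by module)
        | exact Or.inr (Or.inl (by module))
        | exact Or.inr (Or.inr (Or.inl (by module)))
        | exact Or.inr (Or.inr (Or.inr (Or.inl (by module))))
        | exact Or.inr (Or.inr (Or.inr (Or.inr (Or.inl (by module)))))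
        | exact Or.inr (Or.inr (Or.inr (Or.inr (Or.inr (by module)))))
    · -- layer 1
      rw [hL1] at hsq
      push_cast at hsq
      have hsq' : (s 0 : ℝ) ^ 2 = 1 := by rcases hs 0 with h0 | h0 <;> simp [h0]
      rw [hsq'] at hsq
      have hq : ((i : ℝ) ^ 2 + i * j + j ^ 2 + (s 0) * (i + j) + 1 / 3) < 0.84 := by
        nlinarith [ha2]
      left; right
      rw [barlowPos_eq_frame, hL1]
      simp only [Set.mem_insert_iff, Set.mem_singleton_iff]
      rcases layer_one_cases (hs 0) hq with ⟨h0, ⟨rfl, rfl⟩ | ⟨rfl, rfl⟩ | ⟨rfl, rfl⟩⟩ |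
        ⟨h0, ⟨rfl, rfl⟩ | ⟨rfl, rfl⟩ | ⟨rfl, rfl⟩⟩
      all_goals
        rw [h0]; push_cast
        first
        | exact Or.inl (by module)
        | exact Or.inr (Or.inl (by module))
        | exact Or.inr (Or.inr (by module))
    · -- layer -1
      rw [hLm] at hsq
      push_cast at hsq
      have hsq' : (s (-1) : ℝ) ^ 2 = 1 := by rcases hs (-1) with h0 | h0 <;> simp [h0]
      have hq : ((i : ℝ) ^ 2 + i * j + j ^ 2 + ((-s (-1) : ℤ) : ℝ) * (i + j) + 1 / 3) < 0.84 := by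
        push_cast; nlinarith [ha2]
      have hL' : (-s (-1) : ℤ) = 1 ∨ (-s (-1) : ℤ) = -1 := by
        rcases hs (-1) with h0 | h0 <;> simp [h0]
      have hcast : -((s (-1) : ℤ) : ℝ) = ((-s (-1) : ℤ) : ℝ) := by push_cast; ring
      right
      rw [hcast, barlowPos_eq_frame, hLm]
      simp only [Set.mem_insert_iff, Set.mem_singleton_iff]
      rcases layer_one_cases hL' hq with ⟨h0, ⟨rfl, rfl⟩ | ⟨rfl, rfl⟩ | ⟨rfl, rfl⟩⟩ |
        ⟨h0, ⟨rfl, rfl⟩ | ⟨rfl, rfl⟩ | ⟨rfl, rfl⟩⟩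
      all_goals
        rw [h0]; push_cast
        first
        | exact Or.inl (by module)
        | exact Or.inr (Or.inl (by module))
        | exact Or.inr (Or.inr (by module))
  · intro hx
    simp only [Set.mem_union, Set.mem_singleton_iff] at hx
    rcases hx with ((rfl | hx) | hx) | hx
    · exact ⟨⟨0, 0, 0, (barlowPos_zero_zero_zero s).symm⟩,
        Metric.mem_closedBall_self (by positivity)⟩
    · refine ⟨?_, hball x (by rw [inner_self_of_mem_hex hx]; nlinarith)⟩
      simp only [Set.mem_insert_iff, Set.mem_singleton_iff] at hx
      rcases hx with rfl | rfl | rfl | rfl | rfl | rfl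
      · exact ⟨0, 1, 0, by rw [barlowPos_eq_frame, haggLabel_zero]; push_cast; module⟩
      · exact ⟨0, 0, 1, by rw [barlowPos_eq_frame, haggLabel_zero]; push_cast; module⟩
      · exact ⟨0, -1, 0, by rw [barlowPos_eq_frame, haggLabel_zero]; push_cast; module⟩
      · exact ⟨0, 0, -1, by rw [barlowPos_eq_frame, haggLabel_zero]; push_cast; module⟩
      · exact ⟨0, 1, -1, by rw [barlowPos_eq_frame, haggLabel_zero]; push_cast; module⟩
      · exact ⟨0, -1, 1, by rw [barlowPos_eq_frame, haggLabel_zero]; push_cast; module⟩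
    · have hσ : ((s 0 : ℤ) : ℝ) = 1 ∨ ((s 0 : ℤ) : ℝ) = -1 := by
        rcases hs 0 with h0 | h0 <;> simp [h0]
      obtain ⟨t, ht, hxt⟩ := exists_of_mem_up hx
      refine ⟨?_, hball x (by rw [hxt, inner_self_vecE_add_smul hσ ht]; exact hb)⟩
      simp only [Set.mem_insert_iff, Set.mem_singleton_iff] at hx
      rcases hx with rfl | rfl | rfl
      · exact ⟨1, 0, 0, by rw [barlowPos_eq_frame, hL1]; push_cast; module⟩
      · exact ⟨1, -s 0, 0, by rw [barlowPos_eq_frame, hL1]; push_cast; module⟩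
      · exact ⟨1, 0, -s 0, by rw [barlowPos_eq_frame, hL1]; push_cast; module⟩
    · have hσ : (-((s (-1) : ℤ) : ℝ)) = 1 ∨ (-((s (-1) : ℤ) : ℝ)) = -1 := by
        rcases hs (-1) with h0 | h0 <;> simp [h0]
      obtain ⟨t, ht, hxt⟩ := exists_of_mem_dn hx
      refine ⟨?_, hball x (by rw [hxt, inner_self_neg_vecE_add_smul hσ ht]; exact hb)⟩
      simp only [Set.mem_insert_iff, Set.mem_singleton_iff] at hx
      rcases hx with rfl | rfl | rfl
      · exact ⟨-1, 0, 0, by rw [barlowPos_eq_frame, hLm]; push_cast; module⟩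
      · exact ⟨-1, s (-1), 0, by rw [barlowPos_eq_frame, hLm]; push_cast; module⟩
      · exact ⟨-1, 0, s (-1), by rw [barlowPos_eq_frame, hLm]; push_cast; module⟩

/-! ## Reading the star -/

/-- **Off the ideal ratio the norm-`a` points of the standard star are the hexagon**
(`‖± h e₃ + τ t‖² = a²/3 + h² ≠ a²`). [folklore] -/
theorem mem_hex_of_mem_std (ha : 0 < a) (hoff : h ^ 2 ≠ 2 * a ^ 2 / 3) {σ τ : ℝ}
    (hσ : σ = 1 ∨ σ = -1) (hτ : τ = 1 ∨ τ = -1) {x : E3} (hx : x ∈ Std[σ, τ]) (hn : ‖x‖ = a) :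
    x ∈ Hex := by
  have hxx : ⟪x, x⟫ = a ^ 2 := by rw [real_inner_self_eq_norm_sq, hn]
  simp only [Set.mem_union, Set.mem_singleton_iff] at hx
  rcases hx with ((rfl | hx) | hx) | hx
  · rw [norm_zero] at hn
    exact absurd hn ha.ne
  · exact hx
  · obtain ⟨t, ht, rfl⟩ := exists_of_mem_up hx
    rw [inner_self_vecE_add_smul hσ ht] at hxx
    exact absurd (by linarith) hoff
  · obtain ⟨t, ht, rfl⟩ := exists_of_mem_dn hx
    rw [inner_self_neg_vecE_add_smul hτ ht] at hxx
    exact absurd (by linarith) hoff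

/-- **Reading the upper class**: if `h e₃ + σ w` lies in the standard star with classes
`(τ₁, τ₂)` then `σ = τ₁`. [folklore] -/
theorem sign_eq_of_vecE_add_mem_std (ha : 0 < a) (hh : 0 < h) {σ τ₁ τ₂ : ℝ}
    (hσ : σ = 1 ∨ σ = -1) (hτ₁ : τ₁ = 1 ∨ τ₁ = -1) (hτ₂ : τ₂ = 1 ∨ τ₂ = -1)
    (hmem : (𝐞 : E3) + σ • 𝐰 ∈ Std[τ₁, τ₂]) : σ = τ₁ := by
  have h2 : ((𝐞 : E3) + σ • 𝐰) 2 = h := by simp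
  simp only [Set.mem_union, Set.mem_singleton_iff] at hmem
  rcases hmem with ((h0 | hx) | hx) | hx
  · have := congrArg (fun z : E3 => z 2) h0
    simp only [h2, PiLp.zero_apply] at this
    exact absurd this hh.ne'
  · have := apply_two_of_mem_hex hx
    rw [h2] at this
    exact absurd this hh.ne'
  · obtain ⟨t, ht, hxt⟩ := exists_of_mem_up hx
    exact sign_eq_of_smul_vecW_eq ha hσ hτ₁ ht (add_left_cancel hxt)
  · obtain ⟨t, ht, hxt⟩ := exists_of_mem_dn hx
    have := congrArg (fun z : E3 => z 2) hxt
    simp only [h2, PiLp.add_apply, PiLp.neg_apply, PiLp.smul_apply, vecE_apply_two,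
      apply_two_of_mem_holes ht, smul_eq_mul, mul_zero, add_zero] at this
    have _ := hτ₂
    exact absurd (by linarith) hh.ne'

/-- **Reading the lower class**: if `−h e₃ + σ w` lies in the standard star with classes
`(τ₁, τ₂)` then `σ = τ₂`. [folklore] -/
theorem sign_eq_of_neg_vecE_add_mem_std (ha : 0 < a) (hh : 0 < h) {σ τ₁ τ₂ : ℝ}
    (hσ : σ = 1 ∨ σ = -1) (hτ₁ : τ₁ = 1 ∨ τ₁ = -1) (hτ₂ : τ₂ = 1 ∨ τ₂ = -1)
    (hmem : -(𝐞 : E3) + σ • 𝐰 ∈ Std[τ₁, τ₂]) : σ = τ₂ := by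
  have h2 : (-(𝐞 : E3) + σ • 𝐰) 2 = -h := by simp
  simp only [Set.mem_union, Set.mem_singleton_iff] at hmem
  rcases hmem with ((h0 | hx) | hx) | hx
  · have := congrArg (fun z : E3 => z 2) h0
    simp only [h2, PiLp.zero_apply, neg_eq_zero] at this
    exact absurd this hh.ne'
  · have := apply_two_of_mem_hex hx
    rw [h2, neg_eq_zero] at this
    exact absurd this hh.ne'
  · obtain ⟨t, ht, hxt⟩ := exists_of_mem_up hx
    have := congrArg (fun z : E3 => z 2) hxt
    simp only [h2, PiLp.add_apply, PiLp.smul_apply, vecE_apply_two,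
      apply_two_of_mem_holes ht, smul_eq_mul, mul_zero, add_zero] at this
    have _ := hτ₁
    exact absurd (by linarith) hh.ne'
  · obtain ⟨t, ht, hxt⟩ := exists_of_mem_dn hx
    exact sign_eq_of_smul_vecW_eq ha hσ hτ₂ ht (add_left_cancel hxt)


/-- **Registered sub-goal form** of `layeringStar_stacking_inter_closedBall` (closed statement,
notations expanded): the `6a/5`-star of a Barlow stacking on the window is the standard 13-point
star with classes `(s 0, −s(−1))`. [folklore] -/
theorem layeringStar_star_eq_std :
    ∀ {a h : ℝ}, 0 < a → 0 < h → 0.775 * a < h → h < 0.894 * a → ∀ {s : ℤ → ℤ}, IsHaggSeq s →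
      barlowStacking a h s ∩ Metric.closedBall 0 (6 * a / 5) =
        (({0} : Set (EuclideanSpace ℝ (Fin 3))) ∪
          ({triangularVec₁ a, triangularVec₂ a, -triangularVec₁ a, -triangularVec₂ a,
            triangularVec₁ a - triangularVec₂ a, triangularVec₂ a - triangularVec₁ a} :
              Set (EuclideanSpace ℝ (Fin 3))) ∪
          ({layerNormal h + ((s 0 : ℤ) : ℝ) • barlowOffset a,
            layerNormal h + ((s 0 : ℤ) : ℝ) • (barlowOffset a - triangularVec₁ a),
            layerNormal h + ((s 0 : ℤ) : ℝ) • (barlowOffset a - triangularVec₂ a)} :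
              Set (EuclideanSpace ℝ (Fin 3))) ∪
          ({-layerNormal h + (-((s (-1) : ℤ) : ℝ)) • barlowOffset a,
            -layerNormal h + (-((s (-1) : ℤ) : ℝ)) • (barlowOffset a - triangularVec₁ a),
            -layerNormal h + (-((s (-1) : ℤ) : ℝ)) • (barlowOffset a - triangularVec₂ a)} :
              Set (EuclideanSpace ℝ (Fin 3)))) :=
  fun ha hh hw1 hw2 _ hs => layeringStar_stacking_inter_closedBall ha hh hw1 hw2 hs

end Summit.AtomisticToContinuum.Crystallization.Theorems.CLayerWitnessLayering

end
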